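import Mathlib.NumberTheory.RamificationInertia.Basic
import Mathlib.FieldTheory.Galois.Basic
import Literature.NumberTheory.Automorphic.AutomorphicRepsGL
import HarnessLib

/-!
# Global automorphic induction along a cyclic extension: the archimedean components
(Henniart 2012, with Arthur–Clozel and Jacquet–Shalika; named fact, D-0014)

Topic `NumberTheory/Automorphic` (trunk AutomorphicL); work item `wi-10406`, wanted as the
hypothesis of the crux `RegularInductionForcesCM` (stmt-Langlands-2235) of route
`Langlands/SelfDefeatingInduction`.

Let `L/K` be a cyclic extension of number fields of degree `d`, `Γ = Gal(L/K) = ⟨g⟩`. Henniart's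
**global automorphic induction** [Henniart2012] attaches to an automorphic representation `τ` of
`GL_n(𝔸_L)` induced from unitary cuspidal an automorphic representation `π = τ^{L/K}` of
`GL_{nd}(𝔸_K)`, induced from unitary cuspidal, *defined* (§1.10) by the condition that at almost
every place `v` of `K`

  `L(π_v, s) = ∏_{w ∣ v} L(τ_w, s)`                                                    (1.1)

(unique by the rigidity theorem of Jacquet–Shalika, [JacquetShalikaAJM1981II] Thm. 4.4, quoted in
§1.7 and §2.1), and proves: **Théorème 3** — `τ^{L/K}` exists, is induced from unitary cuspidal,
and its base change to `L` is `τ × τ^g × ⋯ × τ^{g^{d-1}}`; **Théorème 4** — base change is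
compatible with the local base change of Arthur–Clozel at *every* place `v` of `K` ("Soit `v` une
place de `F`"; the archimedean case of the transitivity Prop. 3.2 "est clair"); **Théorème 5** with
the closing *Remarque* of §3.7 — `(τ^{L/K})_v` is the local automorphic induction of `τ_v` at every
finite place and, by [4] = Henniart, *Induction automorphe pour GL(n, ℂ)* (2010), also at the
infinite places. At an archimedean place `v` of `K` the algebra `L_v = L ⊗_K K_v` is
`∏_{w ∣ v} L_w`; combining Thm. 3 (i) with Thm. 4 there (archimedean base change `ℂ/ℝ` is
Shintani–Repka's lifting, which "coincides, via the Langlands classification, with restriction on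
the Weil group side", [ArthurClozelAMS120] Ch. 1 §7, and is the identity for `L_w = K_v`) gives
`(τ^{L/K})_v|_{W_{L_w}} ≅ ⊕_{i} (τ^{g^i})_w` on Langlands parameters, i.e. **the restriction to
`ℂ^× ⊆ W_{K_v}` of the parameter of `(τ^{L/K})_v` at an embedding `σ : K → ℂ` inducing `v` is the
direct sum, over the `d` embeddings `σ' : L → ℂ` extending `σ`, of the restrictions to `ℂ^×` of the
parameters of `τ` at `σ'`** (for `v` split in `L` this is just `π_v ≅ ×_{w ∣ v} τ_w`). In the
vocabulary of the tree (`AutomorphicRepsGL`: infinity types `InfinityType K n`, Clozel 1990 §3.3,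
whose `z`-exponent multisets `(T σ).map ArchWeight.a` are what `AutomorphicRepData.HasInfinityType`
pins down) this reads

  `(T_P σ).map a = ∑_{σ' ∣ σ} (T_τ σ').map a`     for every `σ : K →+* ℂ`,

for any infinity types `T_P` of `P = τ^{L/K}` and `T_τ` of `τ`.

## The statement vendored (`Henniart2012_infinityType_of_automorphicInduction`)

For `L/K` Galois with cyclic Galois group, of degree `d`, `n ≥ 1`, a **cuspidal** `P` on
`GL_{dn}(𝔸_K)` and a cuspidal `π` on `GL_n(𝔸_L)` (data `CuspidalAutomorphicRepData`) such that for
almost every finite place `v` of `K` the Satake parameters `α` of `P` at `v` and `β_w` of `π` at the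
`w ∣ v` satisfy `∏_{a ∈ α} (X - a) = ∏_{w ∣ v} ∏_{b ∈ β_w} (X^{f(w|v)} - b)` — which is (1.1) for
the unramified local factors, Arthur–Clozel's Def. 6.1 / (6.1)–(6.2) [ArthurClozelAMS120, Ch. 3 §6]
for arbitrary cyclic degree, and *verbatim the hypothesis of the crux* `RegularInductionForcesCM` —
the conclusion displayed above holds for all infinity types `T_P` of `P`, `T_π` of `π` and all
`σ : K →+* ℂ`, the sum running over the embeddings `σ' : L →+* ℂ` with `σ' ∘ (K → L) = σ`.
Chain of printed results: `P` satisfies Henniart's definition §1.10 of "`P` est induite automorphe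
de `π`", hence (rigidity, §2.1 with [7] Thm. 4.4 and [8]) `P ≅ π^{L/K}` of Théorème 3; then
Théorème 3 (i) + Théorème 4 at the archimedean places (equivalently Théorème 5 + Remarque §3.7)
+ [ArthurClozelAMS120, Ch. 1 §7] give the archimedean components, read on infinity types via
Clozel 1990 §3.3.

## Faithfulness / rendering notes

* *Unitarity.* Henniart's representations are unitary ("cuspidale unitaire", §1.18); the tree's
  `CuspidalAutomorphicRepData` carries no unitarity predicate (none exists in the Borel–Jacquet
  model of `AutomorphicRepsGL`). The statement is made for all cuspidal `P`, `π`: writing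
  `π = π₀ ⊗ |det|_L^s` with `π₀` unitary cuspidal (Borel–Jacquet 1979, 5.7; as in the docstring of
  `AutomorphicRepsGL.exists_isAssociatedL2`), the hypothesis for `(P, π)` is the hypothesis for
  `(P ⊗ |det|_K^{-s}, π₀)` (Satake parameters scale by `q_v^{-s}` resp. `q_w^{-s} = q_v^{-f s}`),
  `P ⊗ |det|_K^{-s}` is cuspidal with unitary central character (its Satake parameters agree a.e.
  with those of the unitary `π₀^{L/K}`), and both sides of the conclusion shift by `(s, s)` at every
  embedding; so the general case is the unitary case. This reduction is the only step not printed
  in [Henniart2012].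
* *Rendering of the archimedean statement.* The tree has no local components `π_v`, no isobaric
  sums and no local base change/induction; archimedean information of an automorphic
  representation datum is available only through `HasArchParameter` / `HasInfinityType` (the
  `z`-exponent multisets at each `σ`, i.e. the restriction to `ℂ^×` of the archimedean Langlands
  parameters, Clozel 1990 §3.3). The identity of multisets above is exactly what "the parameter of
  `P_v` restricted to `W_{L_w} ⊇ ℂ^×` is `⊕_i` (parameter of `(π^{g^i})_w`)" says on these data
  (`Γ` permutes the embeddings of `L` above `σ` simply transitively). Since an infinity type is not
  unique (the pairing `(a_i, b_i)` is not read by `HasInfinityType`), the identity is asserted for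
  *all* infinity types of `P` and `π`.
* *Hypothesis.* The a.e. Satake relation is Henniart's defining condition (1.1) restricted to the
  finite places (a cofinite condition is insensitive to the finitely many others), written with
  `AutomorphicRepData.HasSatakeParamAt` on both sides (same unitary Tamagawa normalisation, under
  which `L(π_w, s) = ∏_{b ∈ β_w} (1 - b q_w^{-s})⁻¹`, `q_w = q_v^{f(w|v)}`), `satakePolynomial`,
  Mathlib's `HeightOneSpectrum.under` and `Ideal.inertiaDeg`, as a `finprod` over the finite set of
  `w ∣ v` — the shape of `automorphicInduction_character` (the `n = 1`, prime-degree existence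
  statement of Arthur–Clozel Thm. 6.2) and of the route's crux.
* *Not vendored here:* the existence of `π^{L/K}` (Théorème 3) and the cuspidality criterion
  (Prop. 2.7: `π^{L/K}` cuspidal iff the `π^{g^i}`, `0 ≤ i < d`, are pairwise non-isomorphic),
  which need Galois conjugates of `π` in the Borel–Jacquet model; the finite-place compatibility
  (Théorème 5), which needs local components. `K L : Type` (universe `0`) is forced by the datum.
* Mathlib: `IsGalois`, `IsCyclic (L ≃ₐ[K] L)`, `Fintype (L →+* ℂ)` (`NumberField.Embeddings`),
  `Filter.cofinite`, `finprod`, `Ideal.inertiaDeg`, `Algebra.IsQuadraticExtension` (used in the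
  proved quadratic corollary). Nothing here duplicates a tree declaration
  (`lean search 'Henniart|automorphicInduction|AutomorphicInduc'`: only
  `automorphicInduction_character` and its bookkeeping lemmas).

## References

* G. Henniart, *Induction automorphe globale pour les corps de nombres*, Bull. Soc. Math. France
  **140** (2012) 1–17, doi:10.24033/bsmf.2622: §1.7, §1.10, Théorèmes 3, 4, 5, §2.1, Prop. 2.7,
  Prop. 3.2, Remarque finale de §3.7. [Henniart2012]
* J. Arthur, L. Clozel, *Simple algebras, base change, and the advanced theory of the trace
  formula*, Ann. of Math. Stud. 120 (1989): Ch. 1 §7 (archimedean base change), Ch. 3 Thm. 5.1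
  (strong lifting), Def. 6.1, Thm. 6.2, (6.1)–(6.2). [ArthurClozelAMS120]
* H. Jacquet, J. Shalika, *On Euler products and the classification of automorphic forms II*,
  Amer. J. Math. **103** (1981) 777–815, Thm. 4.4. [JacquetShalikaAJM1981II]
* L. Clozel, *Motifs et formes automorphes* (1990), §3.3. [Clozel1990]
-/

noncomputable section

open scoped NumberField Polynomial Classical
open NumberField IsDedekindDomain Polynomial Literature.NumberTheory.Automorphic

namespace Literature.NumberTheory.Automorphic

/-- **Archimedean components of a global automorphic induction along a cyclic extension**
(Henniart 2012, Théorème 3 (i) with Théorème 4 / Théorème 5 and the closing Remarque of §3.7,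
definition §1.10 and rigidity §2.1 (Jacquet–Shalika 1981 II, Thm. 4.4); archimedean base change =
restriction of Langlands parameters, Arthur–Clozel 1989, Ch. 1 §7), rendered on infinity types
(Clozel 1990, §3.3). Let `L/K` be a Galois extension of number fields with cyclic Galois group, of
degree `d`, `n ≥ 1`, `P` a cuspidal automorphic representation of `GL_{dn}(𝔸_K)` and `π` a
cuspidal automorphic representation of `GL_n(𝔸_L)` such that for almost every finite place `v` of
`K`, `∏_{a ∈ α_P(v)} (X - a) = ∏_{w ∣ v} ∏_{b ∈ β_π(w)} (X^{f(w|v)} - b)` (Henniart's (1.1):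
`L(P_v, s) = ∏_{w∣v} L(π_w, s)`, i.e. `P` is automorphically induced from `π`, `P ≅ π^{L/K}`).
Then for all infinity types `T_P` of `P`, `T_π` of `π` and every embedding `σ : K →+* ℂ`, the
multiset of `z`-exponents of `T_P` at `σ` is the sum of those of `T_π` at the `d` embeddings
`σ' : L →+* ℂ` extending `σ` — the parameter of `P_v` restricted to `W_{L_w}` is
`⊕_{0 ≤ i < d}` (parameter of `(π^{g^i})_w`); at a place `v` split in `L`,
`P_v ≅ ×_{w ∣ v} π_w`. Stated for all cuspidal `P`, `π` (Henniart: unitary; the general case is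
the unitary one after a twist by `|det|^s`, see the module docstring). Named fact (D-0014).
[cite: Henniart2012, §1.10, Thm. 3 (i), Thm. 4, Thm. 5 and Remarque §3.7]
[cite: ArthurClozelAMS120, Ch. 1 §7 and Ch. 3 Thm. 5.1, Def. 6.1]
[cite: JacquetShalikaAJM1981II, Thm. 4.4] [cite: Clozel1990, §3.3] -/
def Henniart2012_infinityType_of_automorphicInduction : Prop :=
  ∀ (K L : Type) [Field K] [NumberField K] [Field L] [NumberField L] [Algebra K L]
    [IsGalois K L], IsCyclic (L ≃ₐ[K] L) →
    ∀ (n d : ℕ), 0 < n → Module.finrank K L = d →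
    ∀ (hK : isCompact_glFiniteIntegralLevel (d * n) K) (hL : isCompact_glFiniteIntegralLevel n L)
      (P : CuspidalAutomorphicRepData (d * n) K hK) (π : CuspidalAutomorphicRepData n L hL),
      (∀ᶠ v : HeightOneSpectrum (𝓞 K) in Filter.cofinite,
        ∃ (α : Multiset ℂ) (β : HeightOneSpectrum (𝓞 L) → Multiset ℂ),
          P.1.HasSatakeParamAt v α ∧
          (∀ w : HeightOneSpectrum (𝓞 L), w.under (𝓞 K) = v → π.1.HasSatakeParamAt w (β w)) ∧
          satakePolynomial α =
            ∏ᶠ w ∈ {w : HeightOneSpectrum (𝓞 L) | w.under (𝓞 K) = v},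
              (satakePolynomial (β w)).comp (X ^ w.asIdeal.inertiaDeg (𝓞 K))) →
      ∀ (TP : InfinityType K (d * n)) (Tπ : InfinityType L n),
        P.1.HasInfinityType TP → π.1.HasInfinityType Tπ →
        ∀ σ : K →+* ℂ,
          (TP σ).map ArchWeight.a =
            ∑ σ' ∈ Finset.univ.filter (fun σ' : L →+* ℂ => σ'.comp (algebraMap K L) = σ),
              (Tπ σ').map ArchWeight.a

/-- Unfolding lemma for `Henniart2012_infinityType_of_automorphicInduction`. [folklore] -/
theorem Henniart2012_infinityType_of_automorphicInduction_iff :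
    Henniart2012_infinityType_of_automorphicInduction ↔
      ∀ (K L : Type) [Field K] [NumberField K] [Field L] [NumberField L] [Algebra K L]
        [IsGalois K L], IsCyclic (L ≃ₐ[K] L) →
        ∀ (n d : ℕ), 0 < n → Module.finrank K L = d →
        ∀ (hK : isCompact_glFiniteIntegralLevel (d * n) K)
          (hL : isCompact_glFiniteIntegralLevel n L)
          (P : CuspidalAutomorphicRepData (d * n) K hK) (π : CuspidalAutomorphicRepData n L hL),
          (∀ᶠ v : HeightOneSpectrum (𝓞 K) in Filter.cofinite,
            ∃ (α : Multiset ℂ) (β : HeightOneSpectrum (𝓞 L) → Multiset ℂ),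
              P.1.HasSatakeParamAt v α ∧
              (∀ w : HeightOneSpectrum (𝓞 L), w.under (𝓞 K) = v →
                π.1.HasSatakeParamAt w (β w)) ∧
              satakePolynomial α =
                ∏ᶠ w ∈ {w : HeightOneSpectrum (𝓞 L) | w.under (𝓞 K) = v},
                  (satakePolynomial (β w)).comp (X ^ w.asIdeal.inertiaDeg (𝓞 K))) →
          ∀ (TP : InfinityType K (d * n)) (Tπ : InfinityType L n),
            P.1.HasInfinityType TP → π.1.HasInfinityType Tπ →
            ∀ σ : K →+* ℂ,
              (TP σ).map ArchWeight.a =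
                ∑ σ' ∈ Finset.univ.filter (fun σ' : L →+* ℂ => σ'.comp (algebraMap K L) = σ),
                  (Tπ σ').map ArchWeight.a :=
  Iff.rfl

/-- **The quadratic case** (the shape consumed by `RegularInductionForcesCM`: `L/K` of degree `2`,
`P` on `GL_{2n}(𝔸_K)`). A quadratic extension of number fields is Galois with cyclic Galois group
(Mathlib `Algebra.IsQuadraticExtension.isGalois/isCyclic`), so the named fact specialises with no
Galois hypothesis left. [cite: Henniart2012, §1.10, Thm. 3 (i), Thm. 4, Thm. 5 and Remarque §3.7] -/
theorem Henniart2012_infinityType_of_automorphicInduction.quadratic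
    (h : Henniart2012_infinityType_of_automorphicInduction)
    (K L : Type) [Field K] [NumberField K] [Field L] [NumberField L] [Algebra K L]
    (hd : Module.finrank K L = 2) (n : ℕ) (hn : 0 < n)
    (hK : isCompact_glFiniteIntegralLevel (2 * n) K) (hL : isCompact_glFiniteIntegralLevel n L)
    (P : CuspidalAutomorphicRepData (2 * n) K hK) (π : CuspidalAutomorphicRepData n L hL)
    (hAI : ∀ᶠ v : HeightOneSpectrum (𝓞 K) in Filter.cofinite,
      ∃ (α : Multiset ℂ) (β : HeightOneSpectrum (𝓞 L) → Multiset ℂ),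
        P.1.HasSatakeParamAt v α ∧
        (∀ w : HeightOneSpectrum (𝓞 L), w.under (𝓞 K) = v → π.1.HasSatakeParamAt w (β w)) ∧
        satakePolynomial α =
          ∏ᶠ w ∈ {w : HeightOneSpectrum (𝓞 L) | w.under (𝓞 K) = v},
            (satakePolynomial (β w)).comp (X ^ w.asIdeal.inertiaDeg (𝓞 K)))
    (TP : InfinityType K (2 * n)) (Tπ : InfinityType L n) (hTP : P.1.HasInfinityType TP)
    (hTπ : π.1.HasInfinityType Tπ) (σ : K →+* ℂ) :
    (TP σ).map ArchWeight.a =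
      ∑ σ' ∈ Finset.univ.filter (fun σ' : L →+* ℂ => σ'.comp (algebraMap K L) = σ),
        (Tπ σ').map ArchWeight.a := by
  haveI : Algebra.IsQuadraticExtension K L := ⟨hd⟩
  haveI : Module.Finite K L := Module.Finite.of_restrictScalars_finite ℚ K L
  haveI : Algebra.IsSeparable K L := Algebra.IsSeparable.of_integral K L
  haveI : IsGalois K L := Algebra.IsQuadraticExtension.isGalois K L
  exact h K L (Algebra.IsQuadraticExtension.isCyclic K L) n 2 hn hd hK hL P π hAI TP Tπ hTP hTπ σ

end Literature.NumberTheory.Automorphic
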